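import Summits.SmoothPoincare4.SmoothPoincare4.Theses.ConvexBisection
import Summits.SmoothPoincare4.SmoothPoincare4.Theorems.ConvexBisectionSphereSeamStandard
import Summits.SmoothPoincare4.SmoothPoincare4.Theorems.ContractibleTwistedDoubleStandard.Negative.DoubleBisection
import Literature.Topology.FourManifolds.SPC4Wave0
import Literature.Topology.FourManifolds.Gluing
import HarnessLib

/-!
# Stub `stub_absorbingTargets` of line `Sketch` (crux `PlanarAcyclicBisectionRigidity`, stmt-SmoothPoincare4-15086):
# absorbing target (i) — simply connected seam ⇒ `S⁴` — from its three named facts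

The registered stub (RESHAPED in cycle 1 so that the honest cost is explicit): from Perelman
(smooth form, `Literature.Topology.FourManifolds.nonempty_diffeomorph_sphere_three`), Eliashberg 1990
Thm 5.1 (`Literature.Geometry.Symplectic.Eliashberg1990_steinFilling_sphere_three`) and Cerf `Γ₄ = 0`
(`Literature.Topology.FourManifolds.cerf_twistedSphere_four`), a common-contact Stein bisection
`M = e₁(W₁) ∪ e₂(W₂)` (of any `M ≃ₕ S⁴`) whose seam `range e₁ ∩ range e₂` is simply connected is
diffeomorphic to `S⁴`.  Proof (wave-1 stub worker): a boundary datum `b₁` of `W₁` exists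
(`nonempty_boundaryData_holds`); `b₁.carrier ≃ₜ ∂W₁ ≃ₜ e₁(∂W₁) = seam`
(`AbsorbingTargets.seamHomeomorph`) is a compact simply connected smooth 3-manifold, hence `≅ S³`
(Perelman), and the landed core `nonempty_diffeomorph_sphere_four_of_steinBisection_of_diffeomorph`
(`Theorems/ConvexBisectionSphereSeamStandard.lean`: both halves `𝔻⁴` by Eliashberg, twisted
sphere, Cerf) concludes.  Neither item 10510 nor Moise nor `M ≃ₕ S⁴` nor the contact matching is used.
Also: `AbsorbingTargets.seam_homeomorph_sphere_three_of_poincare` — the skeleton's hypothesis shape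
`SeamPoincare` from the topological Perelman fact `nonempty_homeomorph_sphere_three`.
-/

noncomputable section

open scoped Manifold ContDiff Topology ContinuousMap
open Set Function
open Literature.Geometry.Symplectic Literature.AlgebraicTopology.SingularHomology CategoryTheory.Limits
open Literature.Topology.FourManifolds (BoundaryData IsDouble)

-- the prescribed namespace `Summit.<P>.<Sub>.…` duplicates `SmoothPoincare4` (P = Sub)
set_option linter.dupNamespace false

namespace Summit.SmoothPoincare4.SmoothPoincare4.Theorems.PlanarAcyclicBisectionRigidity.Sketch.AbsorbingTargets

open Summit.SmoothPoincare4.SmoothPoincare4.Theses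

/-- Local notation: the round 4-sphere with its Mathlib manifold structure. -/
local notation "𝕊⁴" => (Metric.sphere (0 : EuclideanSpace ℝ (Fin 5)) 1)

/-- Local notation: the model space `ℝ⁴`. -/
local notation "E4" => EuclideanSpace ℝ (Fin 4)

/-! ### The seam as a topological copy of the abstract boundary -/

/-- **The seam of a bisection is homeomorphic to the abstract boundary of the first half.**  For a
smooth embedding `e₁ : W₁ → M` whose image meets `range e₂` exactly in `e₁(∂W₁)`, and a boundary
datum `b₁` of `W₁`, the composite `b₁.carrier ≃ₜ ∂W₁ ≃ₜ e₁(∂W₁) = range e₁ ∩ range e₂`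
(`b₁.incl` and `e₁` are topological embeddings). [folklore] -/
def seamHomeomorph {M : Type*} [TopologicalSpace M] [ChartedSpace E4 M]
    {W₁ : Type*} [TopologicalSpace W₁] [ChartedSpace (EuclideanHalfSpace 4) W₁]
    {W₂ : Type*} {e₁ : W₁ → M} {e₂ : W₂ → M}
    (he₁ : Manifold.IsSmoothEmbedding (𝓡∂ 4) (𝓡 4) ∞ e₁)
    (hseam₁ : range e₁ ∩ range e₂ = e₁ '' (𝓡∂ 4).boundary W₁)
    (b₁ : BoundaryData (𝓡∂ 4) W₁ (𝓡 3)) :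
    b₁.carrier ≃ₜ ↥(range e₁ ∩ range e₂) :=
  ((b₁.isSmoothEmbedding.isEmbedding.toHomeomorph.trans (Homeomorph.setCongr b₁.range_incl)).trans
    ((he₁.isEmbedding.comp Topology.IsEmbedding.subtypeVal).toHomeomorph.trans
      (Homeomorph.setCongr (by rw [Set.range_comp, Subtype.range_val])))).trans
    (Homeomorph.setCongr hseam₁.symm)

/-- **The seam of a bisection by two compact pieces is compact** (intersection of two compact
subsets of a Hausdorff space). [folklore] -/
theorem compactSpace_seam {M : Type*} [TopologicalSpace M] [T2Space M]
    {W₁ : Type*} [TopologicalSpace W₁] [CompactSpace W₁]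
    {W₂ : Type*} [TopologicalSpace W₂] [CompactSpace W₂] {e₁ : W₁ → M} {e₂ : W₂ → M}
    (h₁ : Continuous e₁) (h₂ : Continuous e₂) : CompactSpace ↥(range e₁ ∩ range e₂) :=
  isCompact_iff_compactSpace.mp ((isCompact_range h₁).inter (isCompact_range h₂))

/-! ### Poincaré–Perelman in the shape the skeleton consumes -/

/-- **`Sketch.SeamPoincare` from the tree's named fact (Perelman, topological form).**  Verbatim the
body of the skeleton's hypothesis shape `SeamPoincare`: the boundary `∂W₁` of the first half of a
bisection with simply connected seam is homeomorphic to `S³`.  Proof: a boundary datum `b₁` exists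
(`nonempty_boundaryData_holds`); `b₁.carrier ≃ₜ range e₁ ∩ range e₂` (`seamHomeomorph`) is compact,
Hausdorff, second countable, charted on `ℝ³` and simply connected, so
`Literature.Topology.FourManifolds.nonempty_homeomorph_sphere_three` (Morgan–Tian 2007, Cor. 0.2 (a))
gives `b₁.carrier ≃ₜ S³`, and `∂W₁ ≃ₜ b₁.carrier`.  CONDITIONAL on that undischarged named fact.
[cite: MorganTian2007, Cor. 0.2 (a)] -/
theorem seam_homeomorph_sphere_three_of_poincare
    (hP : Literature.Topology.FourManifolds.nonempty_homeomorph_sphere_three.{0}) :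
    ∀ (M : Type) [TopologicalSpace M] [T2Space M] [SecondCountableTopology M] [ChartedSpace E4 M]
      [IsManifold (𝓡 4) ∞ M]
      (W₁ : Type) [TopologicalSpace W₁] [ChartedSpace (EuclideanHalfSpace 4) W₁] [IsManifold (𝓡∂ 4) ∞ W₁]
      [CompactSpace W₁] (W₂ : Type) [TopologicalSpace W₂] [ChartedSpace (EuclideanHalfSpace 4) W₂]
      [IsManifold (𝓡∂ 4) ∞ W₂] [CompactSpace W₂] (e₁ : W₁ → M) (e₂ : W₂ → M),
      Manifold.IsSmoothEmbedding (𝓡∂ 4) (𝓡 4) ∞ e₁ → Manifold.IsSmoothEmbedding (𝓡∂ 4) (𝓡 4) ∞ e₂ →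
      range e₁ ∩ range e₂ = e₁ '' (𝓡∂ 4).boundary W₁ →
      SimplyConnectedSpace ↥(range e₁ ∩ range e₂) →
      Nonempty (((𝓡∂ 4).boundary W₁) ≃ₜ Metric.sphere (0 : EuclideanSpace ℝ (Fin 4)) 1) := by
  intro M _ _ _ _ _ W₁ _ _ _ _ W₂ _ _ _ _ e₁ e₂ he₁ he₂ hseam₁ hsc
  haveI : T2Space W₁ := he₁.isEmbedding.t2Space
  haveI : SecondCountableTopology W₁ := he₁.isEmbedding.secondCountableTopology
  obtain ⟨b₁⟩ : Nonempty (BoundaryData (𝓡∂ 4) W₁ (𝓡 3)) :=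
    Literature.Topology.FourManifolds.nonempty_boundaryData_holds 3 W₁
  let Θ : b₁.carrier ≃ₜ ↥(range e₁ ∩ range e₂) := AbsorbingTargets.seamHomeomorph he₁ hseam₁ b₁
  haveI : CompactSpace ↥(range e₁ ∩ range e₂) :=
    compactSpace_seam he₁.isEmbedding.continuous he₂.isEmbedding.continuous
  haveI : CompactSpace b₁.carrier := Θ.symm.compactSpace
  haveI : T2Space b₁.carrier := b₁.isSmoothEmbedding.isEmbedding.t2Space
  haveI : SecondCountableTopology b₁.carrier :=
    b₁.isSmoothEmbedding.isEmbedding.secondCountableTopology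
  haveI : SimplyConnectedSpace b₁.carrier := Θ.toHomotopyEquiv.simplyConnectedSpace
  obtain ⟨θ⟩ := hP b₁.carrier
  exact ⟨(b₁.isSmoothEmbedding.isEmbedding.toHomeomorph.trans
    (Homeomorph.setCongr b₁.range_incl)).symm.trans θ⟩

/-! ### Clause (i): simply connected seam, from three named facts -/

end AbsorbingTargets

/-- Local notation: the round 4-sphere with its Mathlib manifold structure. -/
local notation "𝕊⁴" => (Metric.sphere (0 : EuclideanSpace ℝ (Fin 5)) 1)

/-- Local notation: the model space `ℝ⁴`. -/
local notation "E4" => EuclideanSpace ℝ (Fin 4)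

/-- **Registered stub `stub_absorbingTargets` (reshaped, cycle 1): absorbing target (i) from
`{Perelman (smooth), Eliashberg 1990 Thm. 5.1, Cerf Γ₄ = 0}`.**
A common-contact Stein bisection `M = e₁(W₁) ∪ e₂(W₂)` of an `M ≃ₕ S⁴` whose seam
`range e₁ ∩ range e₂` is simply connected is diffeomorphic to `S⁴`: the abstract boundary
`b₁.carrier ≃ₜ` seam is a closed simply connected smooth 3-manifold, hence `≅ S³`
(`nonempty_diffeomorph_sphere_three`, Perelman; Morgan–Tian 2007, Cor. 0.2 (a)), and the landed core
`nonempty_diffeomorph_sphere_four_of_steinBisection_of_diffeomorph` (both halves `𝔻⁴` by Eliashberg,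
twisted sphere, Cerf) concludes.  The homotopy equivalence and the contact matching are not used.
CONDITIONAL on the three undischarged named facts. [cite: MorganTian2007, Cor. 0.2 (a)]
[cite: Eliashberg1990, Thm. 5.1] -/
theorem stub_absorbingTargets
    (hP : Literature.Topology.FourManifolds.nonempty_diffeomorph_sphere_three.{0})
    (hE : Eliashberg1990_steinFilling_sphere_three)
    (hC : Literature.Topology.FourManifolds.cerf_twistedSphere_four) :
    ∀ (M : Type) [TopologicalSpace M] [T2Space M] [SecondCountableTopology M] [ChartedSpace E4 M]
      [IsManifold (𝓡 4) ∞ M] (_hM : M ≃ₕ 𝕊⁴)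
      (W₁ : Type) [TopologicalSpace W₁] [ChartedSpace (EuclideanHalfSpace 4) W₁] [IsManifold (𝓡∂ 4) ∞ W₁]
      [CompactSpace W₁] (W₂ : Type) [TopologicalSpace W₂] [ChartedSpace (EuclideanHalfSpace 4) W₂]
      [IsManifold (𝓡∂ 4) ∞ W₂] [CompactSpace W₂] (J₁ : SteinStructure W₁) (J₂ : SteinStructure W₂)
      (e₁ : W₁ → M) (e₂ : W₂ → M)
      (_he₁ : Manifold.IsSmoothEmbedding (𝓡∂ 4) (𝓡 4) ∞ e₁)
      (_he₂ : Manifold.IsSmoothEmbedding (𝓡∂ 4) (𝓡 4) ∞ e₂)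
      (_hcover : range e₁ ∪ range e₂ = univ)
      (_hseam₁ : range e₁ ∩ range e₂ = e₁ '' (𝓡∂ 4).boundary W₁)
      (_hseam₂ : range e₁ ∩ range e₂ = e₂ '' (𝓡∂ 4).boundary W₂)
      (_hξ : ∀ w₁ w₂, e₁ w₁ = e₂ w₂ →
        Submodule.map (mfderiv (𝓡∂ 4) (𝓡 4) e₁ w₁).toLinearMap (contactPlane J₁.J w₁) =
        Submodule.map (mfderiv (𝓡∂ 4) (𝓡 4) e₂ w₂).toLinearMap (contactPlane J₂.J w₂))
      (_hsc : SimplyConnectedSpace ↥(range e₁ ∩ range e₂)),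
      Nonempty (M ≃ₘ⟮𝓡 4, 𝓡 4⟯ 𝕊⁴) := by
  intro M _ _ _ _ _ _ W₁ _ _ _ _ W₂ _ _ _ _ J₁ J₂ e₁ e₂ he₁ he₂ hcover hseam₁ hseam₂ _ hsc
  haveI : T2Space W₁ := he₁.isEmbedding.t2Space
  haveI : SecondCountableTopology W₁ := he₁.isEmbedding.secondCountableTopology
  obtain ⟨b₁⟩ : Nonempty (BoundaryData (𝓡∂ 4) W₁ (𝓡 3)) :=
    Literature.Topology.FourManifolds.nonempty_boundaryData_holds 3 W₁
  let Θ : b₁.carrier ≃ₜ ↥(range e₁ ∩ range e₂) := AbsorbingTargets.seamHomeomorph he₁ hseam₁ b₁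
  haveI : CompactSpace ↥(range e₁ ∩ range e₂) :=
    AbsorbingTargets.compactSpace_seam he₁.isEmbedding.continuous he₂.isEmbedding.continuous
  haveI : CompactSpace b₁.carrier := Θ.symm.compactSpace
  haveI : T2Space b₁.carrier := b₁.isSmoothEmbedding.isEmbedding.t2Space
  haveI : SecondCountableTopology b₁.carrier :=
    b₁.isSmoothEmbedding.isEmbedding.secondCountableTopology
  haveI : SimplyConnectedSpace b₁.carrier := Θ.toHomotopyEquiv.simplyConnectedSpace
  obtain ⟨Θ₁⟩ := hP b₁.carrier
  exact nonempty_diffeomorph_sphere_four_of_steinBisection_of_diffeomorph hE hC M W₁ W₂ J₁ J₂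
    e₁ e₂ he₁ he₂ hcover hseam₁ hseam₂ b₁ Θ₁

end Summit.SmoothPoincare4.SmoothPoincare4.Theorems.PlanarAcyclicBisectionRigidity.Sketch

end
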